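import Mathlib

/-!
# Crux K2 `PoloidalWindowRigidity` (stmt-NavierStokesRegularity-19708), line `z_shock` — an explicit ENTIRE POLYNOMIAL vector field carrying
# every DIFFERENTIAL clause of `hGN` together with twist and genuine nonlinearity EVERYWHERE: only boundedness and the global type sign fail

`--supports stmt-NavierStokesRegularity-19708 --as helper` (leafhand-ns-poloidalwindowdoor-3 g31, cell decomp-ns, 2026-09-01).  Class-free,
def-free, Mathlib only; companion of the same hand's `…ZShockRotatingShear` (the rotating-shear sector; there at scalar level).  **No stub and
no summit is closed by this file; Navier–Stokes regularity is NOT proved here (rung 0).**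

THE FIELD (the vector-field lift `u = (∇ₕφ, w)`, `φ_z = G(w) + γ(z)`, `Δₕφ = −w_z`, of the polynomial rotating-shear solution of
`…ZShockRotatingShear` with shear `(a, b) = (1, z)`, slope `g(w) = w`, i.e. `G = w²/2`):

  `u₀ = z·x + z²y/2 − z³/6 − z⁵/60`,   `u₁ = z²x/2 + z³y/3 − y²/2 − z⁴/8 − z⁶/72`,   `u₂ = W := x + z·y − z²/2 − z⁴/12`.

Certified below, along coordinate lines (each theorem bundles the `HasDerivAt` facts with the identity, as in g24's `…ZShockSimpleWavesPencilField`):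
* `field_divFree` — `∂ₓu₀ + ∂_yu₁ + ∂_zu₂ = z + (z³/3 − y) + (y − z − z³/3) = 0`;
* `field_poloidal` — `∂ₓu₁ = ∂_yu₀ = z²/2` (third vorticity component `⟪curl u, e₃⟫ = 0`);
* `field_slope` — the AUTONOMOUS slope law `∂_zu₀ = W·∂ₓu₂`, `∂_zu₁ = W·∂_yu₂` with slope `g(u₂) = u₂` a function of the value `u₂` alone
  (so the wedge law `field_wedge` and `hGN`'s autonomy minors hold identically, and `g' ≡ 1`: GENUINELY NONLINEAR at every point);
* `field_twist` — the stubs' twist scalar `∂ₓ(∂_zu₂)·∂_yu₂ − ∂_y(∂_zu₂)·∂ₓu₂ = −1` at EVERY point;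
* `field_type_hyperbolic` / `field_type_elliptic` — the type `∂_zu₀∂ₓu₂ + ∂_zu₁∂_yu₂ = W(1 + z²)` is `< 0` at `(−1,0,0)` and `> 0` at `(1,0,0)`;
* `field_unbounded` — `u₂(x,0,0) = x`: the field is unbounded.
CENSUS READING (crux 19708, deciding class-free statement `hGN` of `…ZShockAutOfSliceLiouville`): an ENTIRE real-analytic (indeed polynomial)
field satisfies divergence-free ∧ e₃-poloidal ∧ wedge ∧ autonomy ∧ «a hyperbolic point» ∧ «a twisting point» ∧ «a genuinely nonlinear point»
simultaneously — so `hGN` is carried exactly by its two remaining clauses, BOUNDEDNESS (of `u`, `∇u`) and the GLOBAL sign «no strictly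
elliptic point»; no argument blind to both can prove it.  With g24's pencil field (all clauses incl. the sign on a half-space, not entire) and
`…ZShockRotatingShear.rotatingShear_rigid` (entire + sign ⇒ rigid in the rotating-shear sector, by finite-height blow-up) this brackets the
statement from both sides inside one solvable sector.  Honest scope: kinematic, explicit, toy; `hGN` / R3 stay XL, not in print. [folklore]
-/

namespace Summit.NavierStokesRegularity.NavierStokesRegularity.Theorems.PoloidalWindowDoorPoloidalWindowRigidityZShockRotatingShearField

-- the summit and its single sub-problem share the name (CONVENTIONS §1)
set_option linter.dupNamespace false

/-! ## One-variable building blocks -/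

/-- `(t²)' = 2t`. [folklore] -/
theorem hpow2 (t : ℝ) : HasDerivAt (fun t : ℝ => t ^ 2) (2 * t) t := by simpa using hasDerivAt_pow 2 t
/-- `(t³)' = 3t²`. [folklore] -/
theorem hpow3 (t : ℝ) : HasDerivAt (fun t : ℝ => t ^ 3) (3 * t ^ 2) t := by simpa using hasDerivAt_pow 3 t
/-- `(t⁴)' = 4t³`. [folklore] -/
theorem hpow4 (t : ℝ) : HasDerivAt (fun t : ℝ => t ^ 4) (4 * t ^ 3) t := by simpa using hasDerivAt_pow 4 t
/-- `(t⁵)' = 5t⁴`. [folklore] -/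
theorem hpow5 (t : ℝ) : HasDerivAt (fun t : ℝ => t ^ 5) (5 * t ^ 4) t := by simpa using hasDerivAt_pow 5 t
/-- `(t⁶)' = 6t⁵`. [folklore] -/
theorem hpow6 (t : ℝ) : HasDerivAt (fun t : ℝ => t ^ 6) (6 * t ^ 5) t := by simpa using hasDerivAt_pow 6 t

/-! ## Partials of the three components along coordinate lines -/

/-- `∂ₓu₀ = z`. [folklore] -/
theorem hasDerivAt_u0_x (x y z : ℝ) :
    HasDerivAt (fun x => z * x + z ^ 2 / 2 * y - z ^ 3 / 6 - z ^ 5 / 60) z x :=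
  (((((hasDerivAt_id' x).const_mul z).add_const (z ^ 2 / 2 * y)).sub_const (z ^ 3 / 6)).sub_const (z ^ 5 / 60)).congr_deriv
    (by ring)

/-- `∂_yu₀ = z²/2`. [folklore] -/
theorem hasDerivAt_u0_y (x y z : ℝ) :
    HasDerivAt (fun y => z * x + z ^ 2 / 2 * y - z ^ 3 / 6 - z ^ 5 / 60) (z ^ 2 / 2) y :=
  (((((hasDerivAt_id' y).const_mul (z ^ 2 / 2)).const_add (z * x)).sub_const (z ^ 3 / 6)).sub_const (z ^ 5 / 60)).congr_deriv
    (by ring)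

/-- `∂_zu₀ = x + zy − z²/2 − z⁴/12 = W`. [folklore] -/
theorem hasDerivAt_u0_z (x y z : ℝ) :
    HasDerivAt (fun z => z * x + z ^ 2 / 2 * y - z ^ 3 / 6 - z ^ 5 / 60) (x + z * y - z ^ 2 / 2 - z ^ 4 / 12) z :=
  (((((hasDerivAt_id' z).mul_const x).fun_add (((hpow2 z).div_const 2).mul_const y)).fun_sub ((hpow3 z).div_const 6)).fun_sub
    ((hpow5 z).div_const 60)).congr_deriv (by ring)

/-- `∂ₓu₁ = z²/2`. [folklore] -/
theorem hasDerivAt_u1_x (x y z : ℝ) :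
    HasDerivAt (fun x => z ^ 2 / 2 * x + z ^ 3 / 3 * y - y ^ 2 / 2 - z ^ 4 / 8 - z ^ 6 / 72) (z ^ 2 / 2) x :=
  ((((((hasDerivAt_id' x).const_mul (z ^ 2 / 2)).add_const (z ^ 3 / 3 * y)).sub_const (y ^ 2 / 2)).sub_const (z ^ 4 / 8)).sub_const
    (z ^ 6 / 72)).congr_deriv (by ring)

/-- `∂_yu₁ = z³/3 − y`. [folklore] -/
theorem hasDerivAt_u1_y (x y z : ℝ) :
    HasDerivAt (fun y => z ^ 2 / 2 * x + z ^ 3 / 3 * y - y ^ 2 / 2 - z ^ 4 / 8 - z ^ 6 / 72) (z ^ 3 / 3 - y) y :=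
  ((((((hasDerivAt_id' y).const_mul (z ^ 3 / 3)).const_add (z ^ 2 / 2 * x)).fun_sub ((hpow2 y).div_const 2)).sub_const
    (z ^ 4 / 8)).sub_const (z ^ 6 / 72)).congr_deriv (by ring)

/-- `∂_zu₁ = zx + z²y − z³/2 − z⁵/12 = z·W`. [folklore] -/
theorem hasDerivAt_u1_z (x y z : ℝ) :
    HasDerivAt (fun z => z ^ 2 / 2 * x + z ^ 3 / 3 * y - y ^ 2 / 2 - z ^ 4 / 8 - z ^ 6 / 72)
      (z * (x + z * y - z ^ 2 / 2 - z ^ 4 / 12)) z :=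
  ((((((hpow2 z).div_const 2).mul_const x).fun_add (((hpow3 z).div_const 3).mul_const y)).sub_const (y ^ 2 / 2)).fun_sub
    ((hpow4 z).div_const 8) |>.fun_sub ((hpow6 z).div_const 72)).congr_deriv (by ring)

/-- `∂ₓu₂ = 1`. [folklore] -/
theorem hasDerivAt_u2_x (x y z : ℝ) : HasDerivAt (fun x => x + z * y - z ^ 2 / 2 - z ^ 4 / 12) 1 x :=
  (((hasDerivAt_id' x).add_const (z * y)).sub_const (z ^ 2 / 2)).sub_const (z ^ 4 / 12)

/-- `∂_yu₂ = z`. [folklore] -/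
theorem hasDerivAt_u2_y (x y z : ℝ) : HasDerivAt (fun y => x + z * y - z ^ 2 / 2 - z ^ 4 / 12) z y :=
  (((((hasDerivAt_id' y).const_mul z).const_add x).sub_const (z ^ 2 / 2)).sub_const (z ^ 4 / 12)).congr_deriv (by ring)

/-- `∂_zu₂ = y − z − z³/3`. [folklore] -/
theorem hasDerivAt_u2_z (x y z : ℝ) : HasDerivAt (fun z => x + z * y - z ^ 2 / 2 - z ^ 4 / 12) (y - z - z ^ 3 / 3) z :=
  (((((hasDerivAt_id' z).mul_const y).const_add x).fun_sub ((hpow2 z).div_const 2)).fun_sub ((hpow4 z).div_const 12)).congr_deriv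
    (by ring)

/-- `∂ₓ(∂_zu₂) = 0` and `∂_y(∂_zu₂) = 1` (for the twist). [folklore] -/
theorem hasDerivAt_u2z_x (y z x : ℝ) : HasDerivAt (fun _ : ℝ => y - z - z ^ 3 / 3) 0 x := hasDerivAt_const x _

/-- `∂_y(∂_zu₂) = 1`. [folklore] -/
theorem hasDerivAt_u2z_y (y z : ℝ) : HasDerivAt (fun y => y - z - z ^ 3 / 3) 1 y :=
  ((hasDerivAt_id' y).sub_const z).sub_const (z ^ 3 / 3)

/-! ## The clauses -/

/-- **Divergence-free**: `∂ₓu₀ + ∂_yu₁ + ∂_zu₂ = 0` at every point (partials certified with the identity). [folklore] -/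
theorem field_divFree (x y z : ℝ) :
    HasDerivAt (fun x => z * x + z ^ 2 / 2 * y - z ^ 3 / 6 - z ^ 5 / 60) z x ∧
    HasDerivAt (fun y => z ^ 2 / 2 * x + z ^ 3 / 3 * y - y ^ 2 / 2 - z ^ 4 / 8 - z ^ 6 / 72) (z ^ 3 / 3 - y) y ∧
    HasDerivAt (fun z => x + z * y - z ^ 2 / 2 - z ^ 4 / 12) (y - z - z ^ 3 / 3) z ∧
    z + (z ^ 3 / 3 - y) + (y - z - z ^ 3 / 3) = 0 :=
  ⟨hasDerivAt_u0_x x y z, hasDerivAt_u1_y x y z, hasDerivAt_u2_z x y z, by ring⟩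

/-- **e₃-poloidal**: `∂ₓu₁ − ∂_yu₀ = 0` (the horizontal field is a gradient on every plane). [folklore] -/
theorem field_poloidal (x y z : ℝ) :
    HasDerivAt (fun x => z ^ 2 / 2 * x + z ^ 3 / 3 * y - y ^ 2 / 2 - z ^ 4 / 8 - z ^ 6 / 72) (z ^ 2 / 2) x ∧
    HasDerivAt (fun y => z * x + z ^ 2 / 2 * y - z ^ 3 / 6 - z ^ 5 / 60) (z ^ 2 / 2) y ∧
    z ^ 2 / 2 - z ^ 2 / 2 = (0 : ℝ) :=
  ⟨hasDerivAt_u1_x x y z, hasDerivAt_u0_y x y z, by ring⟩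

/-- **Autonomous slope law** `∂_zu_b = g(u₂)·∂_bu₂` (`b = 0, 1`) with `g(s) = s` (so `G = s²/2`, `g' ≡ 1`: genuinely nonlinear everywhere, and
the slope depends on the value `u₂ = W` alone — `hGN`'s autonomy minors vanish identically). [folklore] -/
theorem field_slope (x y z : ℝ) :
    HasDerivAt (fun z => z * x + z ^ 2 / 2 * y - z ^ 3 / 6 - z ^ 5 / 60)
      ((x + z * y - z ^ 2 / 2 - z ^ 4 / 12) * 1) z ∧
    HasDerivAt (fun z => z ^ 2 / 2 * x + z ^ 3 / 3 * y - y ^ 2 / 2 - z ^ 4 / 8 - z ^ 6 / 72)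
      ((x + z * y - z ^ 2 / 2 - z ^ 4 / 12) * z) z ∧
    HasDerivAt (fun x => x + z * y - z ^ 2 / 2 - z ^ 4 / 12) 1 x ∧
    HasDerivAt (fun y => x + z * y - z ^ 2 / 2 - z ^ 4 / 12) z y :=
  ⟨(hasDerivAt_u0_z x y z).congr_deriv (by ring), (hasDerivAt_u1_z x y z).congr_deriv (by ring), hasDerivAt_u2_x x y z,
    hasDerivAt_u2_y x y z⟩

/-- **Wedge law** `∂_zu₀·∂_yu₂ − ∂_zu₁·∂ₓu₂ = 0` (immediate from the slope law). [folklore] -/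
theorem field_wedge (x y z : ℝ) :
    (x + z * y - z ^ 2 / 2 - z ^ 4 / 12) * z - z * (x + z * y - z ^ 2 / 2 - z ^ 4 / 12) * 1 = 0 := by ring

/-- **Twist everywhere**: with `∂_zu₂ = y − z − z³/3`, `∂ₓ(∂_zu₂) = 0`, `∂_y(∂_zu₂) = 1`, `∂ₓu₂ = 1`, `∂_yu₂ = z`, the stubs' twist scalar
`∂ₓ(∂_zu₂)·∂_yu₂ − ∂_y(∂_zu₂)·∂ₓu₂` equals `−1 ≠ 0` at EVERY point. [folklore] -/
theorem field_twist (x y z : ℝ) :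
    HasDerivAt (fun _ : ℝ => y - z - z ^ 3 / 3) 0 x ∧ HasDerivAt (fun y => y - z - z ^ 3 / 3) 1 y ∧
    (0 : ℝ) * z - 1 * 1 ≠ 0 :=
  ⟨hasDerivAt_u2z_x y z x, hasDerivAt_u2z_y y z, by norm_num⟩

/-- **Type**: `∂_zu₀∂ₓu₂ + ∂_zu₁∂_yu₂ = W·(1 + z²)`; at `(x,y,z) = (−1,0,0)` it is `−1 < 0` — a strictly HYPERBOLIC point. [folklore] -/
theorem field_type_hyperbolic :
    ((-1 : ℝ) + 0 * 0 - 0 ^ 2 / 2 - 0 ^ 4 / 12) * 1 * 1 + ((-1 : ℝ) + 0 * 0 - 0 ^ 2 / 2 - 0 ^ 4 / 12) * 0 * 0 < 0 := by norm_num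

/-- … and at `(1,0,0)` it is `+1 > 0` — a strictly ELLIPTIC point: the global sign clause of `hGN` fails (as it must, by
`…ZShockRotatingShear.rotatingShear_rigid`). [folklore] -/
theorem field_type_elliptic :
    0 < ((1 : ℝ) + 0 * 0 - 0 ^ 2 / 2 - 0 ^ 4 / 12) * 1 * 1 + ((1 : ℝ) + 0 * 0 - 0 ^ 2 / 2 - 0 ^ 4 / 12) * 0 * 0 := by norm_num

/-- The type quantity in closed form: `∂_zu₀·∂ₓu₂ + ∂_zu₁·∂_yu₂ = W(1 + z²)`, negative exactly on the half-space `{W < 0}`. [folklore] -/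
theorem field_type_formula (x y z : ℝ) :
    (x + z * y - z ^ 2 / 2 - z ^ 4 / 12) * 1 * 1 + (x + z * y - z ^ 2 / 2 - z ^ 4 / 12) * z * z =
      (x + z * y - z ^ 2 / 2 - z ^ 4 / 12) * (1 + z ^ 2) := by ring

/-- **Unbounded**: `u₂(x, 0, 0) = x`, so no bound `M` works — the boundedness clause of `hGN` fails. [folklore] -/
theorem field_unbounded (M : ℝ) : ∃ x : ℝ, M < |x + 0 * 0 - 0 ^ 2 / 2 - 0 ^ 4 / 12| := by
  refine ⟨|M| + 1, ?_⟩
  have h : |M| + 1 + 0 * 0 - 0 ^ 2 / 2 - 0 ^ 4 / 12 = |M| + 1 := by ring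
  rw [h, abs_of_nonneg (by positivity : (0:ℝ) ≤ |M| + 1)]
  linarith [le_abs_self M]

end Summit.NavierStokesRegularity.NavierStokesRegularity.Theorems.PoloidalWindowDoorPoloidalWindowRigidityZShockRotatingShearField
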